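import Literature.NumberTheory.LFunctions.SiegelTatuzawaHoffsteinTheoremOnePrime
import HarnessLib

/-!
# Hoffstein 1980, Theorem 1 (Acta Arith. 38, p. 167) — the discharge of `hoffstein1980_theorem1`

Topic `Literature/NumberTheory/LFunctions`. Everything in this file is PROVED; its last theorem is
`Literature.NumberTheory.LFunctions.hoffstein1980_theorem1_holds : hoffstein1980_theorem1`, discharging the
named fact of `SiegelTatuzawaExplicit.lean`: J. Hoffstein, *On the Siegel–Tatuzawa theorem*, Acta Arith.
**38** (1980) 167–174, THEOREM 1 (p. 167): "Let `1/(6 log 10) > ε > 0`. If `|d| > e^{1/ε}` then with at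
most one exception `L(1, χ) > min[1/(7.735 log|d|), ε/((.349)|d|^ε)]` and
`L(1, χ) > min[1/(7.735 log|d|), ε/((1 + ε log|d|)²(.596)|d|^{.138 ε})]`."

We follow the derivation printed on pp. 172–173 from Theorem 1′
(`Hoffstein1980.theorem1'_of_le`, file `SiegelTatuzawaHoffsteinTheoremOnePrime.lean`), in the pairwise
reading of "with at most one exception" (`AtMostOneException.of_pairwise`): of two real primitive characters
`χ` mod `q`, `χ′` mod `q′` with different value functions and `q ≥ q′ > e^{1/ε} (> 10⁶)`, if
`L(1,χ′) > 1/(7.735 log q′)` then `χ′` satisfies both displays; otherwise (5) holds for `χ′` and Theorem 1′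
gives `min(1/(7.735 log q), T) < L(1,χ)`, `T = 1/(0.5 log q′ (1+y)² (qq′)^{.138/log q′})`,
`y = log q/log q′ ≥ 1`; if `L(1,χ) > 1/(7.735 log q)` we are done, else `T < L(1,χ) ≤ 1/(7.735 log q)`.
Writing `ρ = ε log q′ > 1` (so `ε log q = ρy`, `(qq′)^{.138/log q′} = e^{.138(1+y)}`),
`T = ε/(0.5 ρ (1+y)² e^{.138(1+y)})`, and the two displays follow from
* (second) `ρ(1+y)² ≤ (1+ρy)²`, `e^{.138 y} ≤ e^{.138 ρ y}`, `0.5·e^{.138} ≤ 0.575 < .596` — the source's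
  "the expression decreases as `|d′|` decreases and we can substitute `e^{1/ε}` for `|d′|`" (p. 172);
* (first) `T < 1/(7.735 log q)` reads `15.47 y < (1+y)² e^{.138(1+y)}`, which forces `y > 4.65` and then
  `(1+y)² e^{.138(1+y)} ≤ 0.698 e^{y}` (`key_ineq`; the source: "`y ≥ 4.63`", "`2 log(y+1) < .6139(y+1)`",
  p. 172–173), and `ρ e^{y} ≤ e^{ρy}` (the source: "`x e^{k/x}` decreases until `x = k`", p. 173).
The lead constant `0.5` of `theorem1'_of_le` (print: `.520`, with `.520·e^{.138} = .5969` rounded to `.596`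
on p. 167) is what makes the printed constants `.349`, `.596` come out with margin.

## References

* J. Hoffstein, On the Siegel–Tatuzawa theorem, Acta Arith. 38 (1980) 167–174, Theorem 1 p. 167, proof
  pp. 172–173 (from Theorem 1′ p. 172). [Hoffstein1980SiegelTatuzawa]
-/

noncomputable section

open Complex DirichletCharacter

namespace Literature.NumberTheory.LFunctions

namespace Hoffstein1980

/-! ### Numerics for pp. 172–173 -/

/-- `e^{0.69} ≤ 2`. [folklore] -/
private lemma exp_069_le : Real.exp 0.69 ≤ 2 := by
  refine (Real.exp_bound' (x := 0.69) (by norm_num) (by norm_num) (n := 5) (by norm_num)).trans ?_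
  norm_num [Finset.sum_range_succ, Nat.factorial]

/-- `e^{0.7797} ≤ 2.19`. [folklore] -/
private lemma exp_07797_le : Real.exp 0.7797 ≤ 2.19 := by
  refine (Real.exp_bound' (x := 0.7797) (by norm_num) (by norm_num) (n := 6) (by norm_num)).trans ?_
  norm_num [Finset.sum_range_succ, Nat.factorial]

/-- `e^{0.138} ≤ 1.15`. [folklore] -/
private lemma exp_0138_le : Real.exp 0.138 ≤ 1.15 := by
  refine (Real.exp_bound' (x := 0.138) (by norm_num) (by norm_num) (n := 4) (by norm_num)).trans ?_
  norm_num [Finset.sum_range_succ, Nat.factorial]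

/-- `e^{4.65} ≥ 104.5`. [folklore] -/
private lemma exp_465_ge : (104.5 : ℝ) ≤ Real.exp 4.65 := by
  have h1 : Real.exp 4.65 = Real.exp 1 ^ 4 * Real.exp 0.65 := by
    rw [← Real.exp_nat_mul, ← Real.exp_add]; norm_num
  have h2 : (2.7182818283 : ℝ) ^ 4 ≤ Real.exp 1 ^ 4 :=
    pow_le_pow_left₀ (by norm_num) Real.exp_one_gt_d9.le 4
  have h3 : (1.9144 : ℝ) ≤ Real.exp 0.65 := by
    refine le_trans ?_ (Real.sum_le_exp_of_nonneg (x := 0.65) (by norm_num) 5)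
    norm_num [Finset.sum_range_succ, Nat.factorial]
  rw [h1]
  calc (104.5 : ℝ) ≤ 2.7182818283 ^ 4 * 1.9144 := by norm_num
    _ ≤ Real.exp 1 ^ 4 * Real.exp 0.65 := mul_le_mul h2 h3 (by norm_num) (by positivity)

/-- The numerical heart of pp. 172–173 (with the constants of `theorem1'_of_le`): for `y ≥ 1`,
`15.47 y < (1+y)² e^{.138(1+y)}` forces `y > 4.65`, and then `(1+y)² e^{.138(1+y)} ≤ 0.698 e^{y}`
(print: "as `y ≥ 4.63`", "`2 log(y+1) < .6139(y+1)`"). [cite: Hoffstein1980SiegelTatuzawa, pp. 172–173] -/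
theorem key_ineq {y : ℝ} (hy : 1 ≤ y)
    (hC : 15.47 * y < (1 + y) ^ 2 * Real.exp (0.138 * (1 + y))) :
    (1 + y) ^ 2 * Real.exp (0.138 * (1 + y)) ≤ 0.698 * Real.exp y := by
  by_cases h4 : y ≤ 4
  · exfalso
    have hE : Real.exp (0.138 * (1 + y)) ≤ 2 :=
      (Real.exp_le_exp.2 (by nlinarith)).trans exp_069_le
    have h' : (1 + y) ^ 2 * Real.exp (0.138 * (1 + y)) ≤ (1 + y) ^ 2 * 2 :=
      mul_le_mul_of_nonneg_left hE (by positivity)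
    nlinarith [mul_nonneg (sub_nonneg.2 hy) (sub_nonneg.2 h4)]
  by_cases h465 : y ≤ 4.65
  · exfalso
    have hE : Real.exp (0.138 * (1 + y)) ≤ 2.19 :=
      (Real.exp_le_exp.2 (by nlinarith)).trans exp_07797_le
    have h' : (1 + y) ^ 2 * Real.exp (0.138 * (1 + y)) ≤ (1 + y) ^ 2 * 2.19 :=
      mul_le_mul_of_nonneg_left hE (by positivity)
    nlinarith [mul_nonneg (sub_nonneg.2 (not_le.1 h4).le) (sub_nonneg.2 h465)]
  push Not at h4 h465
  obtain ⟨s, hs⟩ : ∃ s : ℝ, s = y - 4.65 := ⟨_, rfl⟩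
  have hs0 : 0 ≤ s := by linarith
  have hy' : y = 4.65 + s := by linarith
  have e1 : Real.exp (0.138 * (1 + y)) = Real.exp 0.7797 * Real.exp (0.138 * s) := by
    rw [← Real.exp_add, hy']; ring_nf
  have e2 : Real.exp y = Real.exp 4.65 * Real.exp (0.138 * s) * Real.exp (0.862 * s) := by
    rw [← Real.exp_add, ← Real.exp_add, hy']; ring_nf
  rw [e1, e2, hy']
  have hq := Real.quadratic_le_exp_of_nonneg (x := 0.862 * s) (by positivity)
  have hpos : 0 < Real.exp (0.138 * s) := Real.exp_pos _
  have key : (1 + (4.65 + s)) ^ 2 * Real.exp 0.7797 ≤ 0.698 * Real.exp 4.65 * Real.exp (0.862 * s) :=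
    calc (1 + (4.65 + s)) ^ 2 * Real.exp 0.7797 ≤ (1 + (4.65 + s)) ^ 2 * 2.19 :=
          mul_le_mul_of_nonneg_left exp_07797_le (by positivity)
      _ ≤ 0.698 * 104.5 * (1 + 0.862 * s + (0.862 * s) ^ 2 / 2) := by
          nlinarith [mul_nonneg hs0 hs0]
      _ ≤ 0.698 * Real.exp 4.65 * Real.exp (0.862 * s) :=
          mul_le_mul (mul_le_mul_of_nonneg_left exp_465_ge (by norm_num)) hq (by positivity)
            (by positivity)
  calc (1 + (4.65 + s)) ^ 2 * (Real.exp 0.7797 * Real.exp (0.138 * s))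
        = ((1 + (4.65 + s)) ^ 2 * Real.exp 0.7797) * Real.exp (0.138 * s) := by ring
    _ ≤ (0.698 * Real.exp 4.65 * Real.exp (0.862 * s)) * Real.exp (0.138 * s) :=
        mul_le_mul_of_nonneg_right key hpos.le
    _ = 0.698 * (Real.exp 4.65 * Real.exp (0.138 * s) * Real.exp (0.862 * s)) := by ring

/-- `ρ e^{y} ≤ e^{ρy}` for `ρ, y ≥ 1` (the source: "`x e^{k/x}` decreases until reaching a minimum at
`x = k`", p. 173). [cite: Hoffstein1980SiegelTatuzawa, p. 173] -/
theorem mul_exp_le_exp_mul {ρ y : ℝ} (hρ : 1 ≤ ρ) (hy : 1 ≤ y) :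
    ρ * Real.exp y ≤ Real.exp (ρ * y) := by
  have h1 : Real.exp (ρ * y) = Real.exp y * Real.exp ((ρ - 1) * y) := by
    rw [← Real.exp_add]; ring_nf
  have h2 : (ρ - 1) * y + 1 ≤ Real.exp ((ρ - 1) * y) := Real.add_one_le_exp _
  have h3 : ρ ≤ (ρ - 1) * y + 1 := by nlinarith
  rw [h1]
  nlinarith [Real.exp_pos y, h2, h3]

/-- `ρ(1+y)² ≤ (1+ρy)²` for `ρ, y ≥ 1` (`(1+ρy)² − ρ(1+y)² = (ρ−1)(ρy²−1)`). [folklore] -/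
private lemma mul_sq_le_sq {ρ y : ℝ} (hρ : 1 ≤ ρ) (hy : 1 ≤ y) :
    ρ * (1 + y) ^ 2 ≤ (1 + ρ * y) ^ 2 := by
  have h : 0 ≤ (ρ - 1) * (ρ * y ^ 2 - 1) := mul_nonneg (by linarith) (by nlinarith)
  nlinarith [h]

/-! ### Theorem 1 -/

/-- **Hoffstein 1980, Theorem 1, pairwise form (pp. 167, 172–173).** For `0 < ε < 1/(6 log 10)` and two
real primitive characters `χ` mod `q`, `χ′` mod `q′` with different value functions and
`q ≥ q′ > e^{1/ε}`: `χ` or `χ′` satisfies both displayed bounds of Theorem 1. Derived from Theorem 1′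
(`theorem1'_of_le`) as on pp. 172–173 (see the module docstring).
[cite: Hoffstein1980SiegelTatuzawa, Theorem 1 p. 167, proof pp. 172–173] -/
theorem theorem1_pair {ε : ℝ} (hε : 0 < ε) (hε' : ε < 1 / (6 * Real.log 10))
    {q : ℕ} [NeZero q] (χ : DirichletCharacter ℂ q) {q' : ℕ} [NeZero q']
    (χ' : DirichletCharacter ℂ q') (hχp : χ.IsPrimitive) (hχq : χ.IsQuadratic) (hχ1 : χ ≠ 1)
    (hχ'p : χ'.IsPrimitive) (hχ'q : χ'.IsQuadratic) (hχ'1 : χ' ≠ 1)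
    (hne : (fun n : ℕ ↦ χ n) ≠ fun n : ℕ ↦ χ' n) (hq'ε : Real.exp (1 / ε) < q') (hqq' : q' ≤ q) :
    (min (1 / (7.735 * Real.log q)) (ε / (0.349 * (q : ℝ) ^ ε)) < (χ.LFunction 1).re ∧
      min (1 / (7.735 * Real.log q))
        (ε / ((1 + ε * Real.log q) ^ 2 * 0.596 * (q : ℝ) ^ (0.138 * ε))) < (χ.LFunction 1).re) ∨
    (min (1 / (7.735 * Real.log q')) (ε / (0.349 * (q' : ℝ) ^ ε)) < (χ'.LFunction 1).re ∧
      min (1 / (7.735 * Real.log q'))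
        (ε / ((1 + ε * Real.log q') ^ 2 * 0.596 * (q' : ℝ) ^ (0.138 * ε))) < (χ'.LFunction 1).re) := by
  -- `q′ > e^{1/ε} > 10⁶`
  have hl10 : 0 < Real.log 10 := Real.log_pos (by norm_num)
  have h6 : 6 * Real.log 10 < 1 / ε := (lt_one_div (by positivity) hε).mpr hε'
  have h106 : (10 ^ 6 : ℝ) < q' := by
    have : Real.exp (6 * Real.log 10) = (10 : ℝ) ^ 6 := by
      rw [show (6 : ℝ) * Real.log 10 = Real.log ((10 : ℝ) ^ 6) by rw [Real.log_pow]; norm_num]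
      exact Real.exp_log (by positivity)
    calc (10 ^ 6 : ℝ) = Real.exp (6 * Real.log 10) := this.symm
      _ < Real.exp (1 / ε) := Real.exp_lt_exp.2 h6
      _ < q' := hq'ε
  have hq'0 : (0 : ℝ) < q' := lt_trans (by norm_num) h106
  have hqq'r : (q' : ℝ) ≤ q := by exact_mod_cast hqq'
  have hq0 : (0 : ℝ) < q := lt_of_lt_of_le hq'0 hqq'r
  have hε1 : 0 < 1 / ε := by positivity
  have hlq' : 1 / ε < Real.log q' := (Real.lt_log_iff_exp_lt hq'0).2 hq'ε
  have hlqq' : Real.log q' ≤ Real.log q := Real.log_le_log hq'0 hqq'r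
  have hL'0 : 0 < Real.log q' := hε1.trans hlq'
  have hL0 : 0 < Real.log q := lt_of_lt_of_le hL'0 hlqq'
  by_cases hL' : 1 / (7.735 * Real.log q') < (χ'.LFunction 1).re
  · exact Or.inr ⟨lt_of_le_of_lt (min_le_left _ _) hL', lt_of_le_of_lt (min_le_left _ _) hL'⟩
  left
  push Not at hL'
  have h1 := theorem1'_of_le χ χ' hχp hχq hχ1 hχ'p hχ'q hχ'1 hne h106 hqq' hL'
  by_cases hL : 1 / (7.735 * Real.log q) < (χ.LFunction 1).re
  · exact ⟨lt_of_le_of_lt (min_le_left _ _) hL, lt_of_le_of_lt (min_le_left _ _) hL⟩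
  push Not at hL
  have hT := (min_lt_iff.mp h1).resolve_left (not_lt.mpr hL)
  -- notation: `y = log q / log q′ ≥ 1`, `ρ = ε log q′ > 1`
  obtain ⟨y, hydef⟩ : ∃ y : ℝ, y = Real.log q / Real.log q' := ⟨_, rfl⟩
  obtain ⟨ρ, hρdef⟩ : ∃ ρ : ℝ, ρ = ε * Real.log q' := ⟨_, rfl⟩
  have hLq : Real.log q = y * Real.log q' := by rw [hydef]; field_simp
  have hy1 : 1 ≤ y := by rw [hydef, le_div_iff₀ hL'0, one_mul]; exact hlqq'
  have hy0 : 0 < y := lt_of_lt_of_le one_pos hy1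
  have hρ1' : 1 < ρ := by
    have h := mul_lt_mul_of_pos_left hlq' hε
    rwa [mul_one_div_cancel hε.ne', ← hρdef] at h
  have hρ1 : 1 ≤ ρ := hρ1'.le
  have hρ0 : 0 < ρ := lt_trans one_pos hρ1'
  have hεLq : ε * Real.log q = ρ * y := by rw [hLq, hρdef]; ring
  have hE : ((q : ℝ) * q') ^ (0.138 / Real.log q') = Real.exp (0.138 * (1 + y)) := by
    rw [Real.rpow_def_of_pos (by positivity), Real.log_mul hq0.ne' hq'0.ne', hLq]
    congr 1
    field_simp
    ring
  have hqε : (q : ℝ) ^ ε = Real.exp (ρ * y) := by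
    rw [Real.rpow_def_of_pos hq0, mul_comm, hεLq]
  have hqε' : (q : ℝ) ^ (0.138 * ε) = Real.exp (0.138 * (ρ * y)) := by
    rw [Real.rpow_def_of_pos hq0, ← hεLq]
    ring_nf
  have h1y : 1 + Real.log q / Real.log q' = 1 + y := by rw [hydef]
  have h1ε : 1 + ε * Real.log q = 1 + ρ * y := by rw [hεLq]
  have hEpos : 0 < Real.exp (0.138 * (1 + y)) := Real.exp_pos _
  -- `T = ε/(0.5 ρ (1+y)² e^{.138(1+y)})`
  have hTeq : 1 / (0.5 * Real.log q' * (1 + Real.log q / Real.log q') ^ 2 *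
      ((q : ℝ) * q') ^ (0.138 / Real.log q')) =
      ε / (0.5 * ρ * (1 + y) ^ 2 * Real.exp (0.138 * (1 + y))) := by
    rw [hE, h1y, hρdef]
    field_simp
  rw [hTeq] at hT
  -- (C): `T < 1/(7.735 log q)` reads `15.47 y < (1+y)² e^{.138(1+y)}`
  have hTa := lt_of_lt_of_le hT hL
  have hC : 15.47 * y < (1 + y) ^ 2 * Real.exp (0.138 * (1 + y)) := by
    rw [hLq, div_lt_div_iff₀ (by positivity) (by positivity), hρdef] at hTa
    have h2 : ε * Real.log q' * (15.47 * y) <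
        ε * Real.log q' * ((1 + y) ^ 2 * Real.exp (0.138 * (1 + y))) := by linarith [hTa]
    exact lt_of_mul_lt_mul_left h2 (by positivity)
  have hkey := key_ineq hy1 hC
  constructor
  · -- first display: `ε/(.349 q^ε) ≤ T < L(1,χ)`
    refine lt_of_le_of_lt ((min_le_right _ _).trans ?_) hT
    rw [hqε, div_le_div_iff₀ (by positivity) (by positivity)]
    have h2 := mul_exp_le_exp_mul hρ1 hy1
    calc ε * (0.5 * ρ * (1 + y) ^ 2 * Real.exp (0.138 * (1 + y)))
          = ε * (0.5 * ρ) * ((1 + y) ^ 2 * Real.exp (0.138 * (1 + y))) := by ring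
      _ ≤ ε * (0.5 * ρ) * (0.698 * Real.exp y) := mul_le_mul_of_nonneg_left hkey (by positivity)
      _ = ε * (0.349 * (ρ * Real.exp y)) := by ring
      _ ≤ ε * (0.349 * Real.exp (ρ * y)) := by gcongr
  · -- second display: `ε/((1+ε log q)² .596 q^{.138ε}) ≤ T < L(1,χ)`
    refine lt_of_le_of_lt ((min_le_right _ _).trans ?_) hT
    have h1ρy : 0 < 1 + ρ * y := by positivity
    rw [hqε', h1ε, div_le_div_iff₀ (by positivity) (by positivity)]
    have hE' : Real.exp (0.138 * (1 + y)) ≤ 1.15 * Real.exp (0.138 * (ρ * y)) := by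
      have e : Real.exp (0.138 * (1 + y)) = Real.exp 0.138 * Real.exp (0.138 * y) := by
        rw [← Real.exp_add]; ring_nf
      rw [e]
      exact mul_le_mul exp_0138_le (Real.exp_le_exp.2 (by nlinarith [mul_nonneg (sub_nonneg.2 hρ1) hy0.le]))
        (by positivity) (by norm_num)
    have hsq := mul_sq_le_sq hρ1 hy1
    calc ε * (0.5 * ρ * (1 + y) ^ 2 * Real.exp (0.138 * (1 + y)))
          = ε * 0.5 * (ρ * (1 + y) ^ 2) * Real.exp (0.138 * (1 + y)) := by ring
      _ ≤ ε * 0.5 * (1 + ρ * y) ^ 2 * (1.15 * Real.exp (0.138 * (ρ * y))) := by gcongr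
      _ = ε * ((1 + ρ * y) ^ 2 * 0.575 * Real.exp (0.138 * (ρ * y))) := by ring
      _ ≤ ε * ((1 + ρ * y) ^ 2 * 0.596 * Real.exp (0.138 * (ρ * y))) := by gcongr; norm_num

end Hoffstein1980

/-- **Hoffstein 1980, Theorem 1 (p. 167) — DISCHARGED.** "Let `1/(6 log 10) > ε > 0`. If `|d| > e^{1/ε}`
then with at most one exception `L(1, χ) > min[1/(7.735 log|d|), ε/((.349)|d|^ε)]` and
`L(1, χ) > min[1/(7.735 log|d|), ε/((1 + ε log|d|)²(.596)|d|^{.138 ε})]`." From the pairwise form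
`Hoffstein1980.theorem1_pair` (Theorem 1′ + pp. 172–173) and `AtMostOneException.of_pairwise`.
[cite: Hoffstein1980SiegelTatuzawa, Theorem 1 p. 167, proof pp. 172–173] -/
theorem hoffstein1980_theorem1_holds : hoffstein1980_theorem1 := by
  intro ε hε hε'
  refine AtMostOneException.of_pairwise fun {q} _ χ hp hq h1 {q'} _ χ' hp' hq' h1' hdiff ↦ ?_
  rcases le_total q' q with hle | hle
  · by_cases hq'ε : Real.exp (1 / ε) < (q' : ℝ)
    · rcases Hoffstein1980.theorem1_pair hε hε' χ χ' hp hq h1 hp' hq' h1' hdiff hq'ε hle with h | h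
      · exact Or.inl fun _ ↦ h
      · exact Or.inr fun _ ↦ h
    · exact Or.inr fun h ↦ absurd h hq'ε
  · by_cases hqε : Real.exp (1 / ε) < (q : ℝ)
    · rcases Hoffstein1980.theorem1_pair hε hε' χ' χ hp' hq' h1' hp hq h1 (Ne.symm hdiff) hqε hle
        with h | h
      · exact Or.inr fun _ ↦ h
      · exact Or.inl fun _ ↦ h
    · exact Or.inl fun h ↦ absurd h hqε

end Literature.NumberTheory.LFunctions

end
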